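import Summits.NavierStokesRegularity.NavierStokesRegularity.Theorems.StrainDoorsSliceConcentrationCriterionCore
import HarnessLib

/-!
(Tree file 2 of 2 of PART M §M26 — ROUND 68 text N8 of nsreg-p1 g37, `r68/StrainDoorsSliceConcentrationCriterion.lean`
sha256 cca4511d32be01ee (586 l.), split by the landing hand (ns-s30-p1 g6) at the § boundary §M26(c)/(d) to respect the
400-line cap; declarations byte-identical.  THIS file = §M26(d) under the text's module name; §M26(a)–(c) are in
`StrainDoorsSliceConcentrationCriterionCore`, imported below.)

# Strain doors, PART M §M26 — Barker–Prange's Theorem 3 (directions along a SEQUENCE of times) with a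
# FIXED `δ₀`, reduced to every-time `L³` concentration at Type-I singular points

ROUND 68 of the `ns-regularity-ideate` p1 line (helper lane of `stmt-NavierStokesRegularity-0056`, rung N0;
nothing here is a claim about Navier–Stokes regularity — Type-I singular points are excluded under a direction
hypothesis AND a concentration door; nothing about Type II).

* §M26(a) typed door `SliceL3Concentration` («X», OPEN as typed): at a singular point of a Leray–Hopf solution
  with the global sup-norm Type-I bound `|u| ≤ M/√(T − t)`, the `L³` norm on the balls `B̄(x₀, R_M √(T − t))`
  stays `≥ γ_M` for ALL `t` close to `T`, with `γ_M`, `R_M` depending on `M` ONLY.  Barker–Prange 2020 (ARMA)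
  Thm 2 (tree: `BarkerPrange2020_thm2_holds`; local-in-time version PROVED in §M27) gives this under the
  MORREY-type bound `‖u(t)‖_{L²(B_r(x̄))} ≤ M₂√r`, which follows from the sup-norm bound only with a
  SOLUTION-DEPENDENT `M₂` (Barker–Prange 2020 p. 5, Seregin–Zajączkowski) — the `M`-only form is the content
  of the door.
* §M26(b) ★★★ `sliceCoherence_smallMass` (PROVED): for `M`, `R' > 0`, `R_m`, `γ > 0` there is `δ > 0` such that
  every `U ∈ 𝓐_M` (`IsTypeIAncientMild M`) whose vorticity directions at the single slice `s = −4` oscillate by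
  `≤ δ` on `B(0,R') ∖ {ω = 0}` has `∫_{B̄(0,R_m)} |U(−4)|³ < γ` — compactness (P2) + the one-slice Liouville
  theorems of §M18 + dominated convergence.
* §M26(c) ★★★ `exists_zoomLimit_at_singular_along₆₈`: the tree's Barker–Prange zoom along a sequence of times,
  re-exporting the VELOCITY convergence at the slice `−4` (the tree keeps only the vorticity).
* §M26(d) ★★★ `frequently_slice_smallMass_of_sliceAligned` (PROVED, the core): `δ₀(M,R,R_m,γ)`-aligned slices
  `s_n → T` at a SINGULAR point have `∫_{B̄(x₀,R_m√(T−s_n))} |u(s_n)|³ < γ` for infinitely many `n` (zoom along the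
  sequence + (b)); ★★★★ `sliceAligned_fixedDelta_not_singular_of_sliceL3Concentration` (PROVED):
  `SliceL3Concentration →` for every `M`, `R > 0` there is `δ₀(M,R) > 0` such that a Leray–Hopf solution with
  the global Type-I bound whose vorticity directions satisfy `|ξ(x,s_n) − ξ(y,s_n)| ≤ δ₀` for `x, y ∈
  B(x₀, R√(T − s_n)) ∩ {|ω| > d}` along SOME sequence `s_n → T` is not singular at `(T,x₀)` — Barker–Prange's
  Theorem 3 with the modulus `η` replaced by a fixed `δ₀(M,R)`, CONDITIONAL on the door X.  The UNCONDITIONAL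
  version with `δ₀(M,M₂,R)` under the additional Morrey-type Type-I bound is §M27
  (`StrainDoorsMorreyTypeIFixedDelta`).

Honest status: the `M`-only (d) is conditional on X, which is OPEN as typed (see (a)); `δ₀` is ineffective
(contradiction + compactness).  Why a door at all: with a FIXED `δ₀` the blow-up limit along the sequence is only
`δ₀`-coherent at ONE slice (a modulus `η(|x − y|)` would make it PARALLEL there, whence Barker–Prange's Liouville
step); a second compactness–contradiction step à la Giga–Miura then needs a QUANTITATIVE non-degeneracy of the
limit slice with constants fixed before the solution — every-time `L³` concentration is exactly that.

References: Barker–Prange, Arch. Ration. Mech. Anal. 235 (2020) (arXiv:1812.09115) Thm 2; Barker–Prange,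
arXiv:1906.08225, Thm 3 and §4; Giga–Miura, Comm. Math. Phys. 303 (2011) Thm 1.1; Seregin–Šverák 2009 Thm 2.8;
Albritton–Barker, J. Math. Fluid Mech. 21 (2019) Lemma 2.5.
-/

noncomputable section

-- the summit and its single problem share the name `NavierStokesRegularity` (D-0017 nested layout)
set_option linter.dupNamespace false

open MeasureTheory Set Function Filter Metric Real InnerProductSpace
open _root_.Topology
open scoped ENNReal NNReal RealInnerProductSpace ContDiff
open Literature.Analysis Literature.Analysis.FluidPDE Literature.Analysis.FluidPDE.LocalTypeIBlowup

namespace Summit.NavierStokesRegularity.NavierStokesRegularity.Theorems.StrainDoors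

/-! ### §M26(d) A `δ₀`-aligned sequence of slices carries small `L³` mass; Barker–Prange's Theorem 3
### with a FIXED `δ₀`, conditional on the door X -/

/-- ★★★ **CORE: `δ₀`-ALIGNED SLICES AT A SINGULAR POINT HAVE SMALL SIMILARITY-SCALE `L³` MASS
INFINITELY OFTEN.**  For `M`, `R > 0`, `R_m > 0`, `γ > 0` there is `δ₀ = δ₀(M,R,R_m,γ) > 0` such that: if
`(u,p)` is a classical solution of the unit-viscosity unforced Navier–Stokes system on `ℝ³ × [0,T)`,
Leray–Hopf on `[0,T)`, with the global Type-I bound `|u| ≤ M/√(T − t)`, if along a sequence of times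
`s_n → T` in `(0,T)` the vorticity directions satisfy `|ξ(x,s_n) − ξ(y,s_n)| ≤ δ₀` for
`x, y ∈ B(x₀, R√(T − s_n)) ∩ {|ω(·,s_n)| > d}`, and if `(T,x₀)` IS a singular point, then for
infinitely many `n`, `∫_{B̄(x₀, R_m √(T − s_n))} |u(s_n)|³ < γ`.
Proof: otherwise a tail has mass `≥ γ`; zoom along it (`exists_zoomLimit_at_singular_along₆₈`): the zoomed
slices at `−4` have mass `≥ γ` on `B̄(0,2R_m)` (scale invariance, `setIntegral_norm_zoom_pow_three`), which
passes to the limit `U(−4)` (dominated convergence, `|zoom| ≤ M/2`), while the `δ₀`-coherence passes to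
`U(−4)` on `B(0,2R) ∖ {ω_U(−4) = 0}` (thresholds blow up under the zoom, directions are invariant) —
contradicting `sliceCoherence_smallMass` at `(M, 2R, 2R_m, γ)`.
[cite: BarkerPrange2020Alignment, Thm 3 and §4 (arXiv:1906.08225 pp. 16–18); GigaMiura2011, Thm 1.1] -/
theorem frequently_slice_smallMass_of_sliceAligned (M : ℝ) {R : ℝ} (hR : 0 < R) {Rm : ℝ} (hRm : 0 < Rm)
    {γ : ℝ} (hγ : 0 < γ) :
    ∃ δ₀ : ℝ, 0 < δ₀ ∧
      ∀ (T : ℝ) (u : ℝ → EuclideanSpace ℝ (Fin 3) → EuclideanSpace ℝ (Fin 3))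
        (p : ℝ → EuclideanSpace ℝ (Fin 3) → ℝ), 0 < T →
        IsClassicalNSSolutionOn (Ico 0 T) 1 0 u p → IsLerayHopfOn T 1 0 (u 0) u →
        (∀ t ∈ Ioo 0 T, ∀ x : EuclideanSpace ℝ (Fin 3), ‖u t x‖ ≤ M / Real.sqrt (T - t)) →
        ∀ (x₀ : EuclideanSpace ℝ (Fin 3)) (d : ℝ) (s : ℕ → ℝ), (∀ n, s n ∈ Ioo 0 T) →
          Tendsto s atTop (𝓝 T) →
          (∀ (n : ℕ) (x y : EuclideanSpace ℝ (Fin 3)), x ∈ ball x₀ (R * Real.sqrt (T - s n)) →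
            y ∈ ball x₀ (R * Real.sqrt (T - s n)) → d < ‖curl (u (s n)) x‖ → d < ‖curl (u (s n)) y‖ →
              ‖vorticityDirection (curl (u (s n))) x - vorticityDirection (curl (u (s n))) y‖ ≤ δ₀) →
          IsBackwardSingularPoint u (T, x₀) →
          ∀ N : ℕ, ∃ n, N ≤ n ∧
            ∫ x in closedBall x₀ (Rm * Real.sqrt (T - s n)), ‖u (s n) x‖ ^ 3 < γ := by
  have h2R : 0 < 2 * R := by positivity
  obtain ⟨δ₀, hδ₀, hsmall⟩ := sliceCoherence_smallMass M h2R (2 * Rm) hγ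
  refine ⟨δ₀, hδ₀, ?_⟩
  intro T u p hT hcl hLH hI x₀ d s hs hsT hcoh hsing N
  by_contra hall
  push Not at hall
  -- (1) the tail `s' n = s (n + N)` carries mass `≥ γ`
  set s' : ℕ → ℝ := fun n => s (n + N) with hs'def
  have hs' : ∀ n, s' n ∈ Ioo 0 T := fun n => hs (n + N)
  have hs'T : Tendsto s' atTop (𝓝 T) := hsT.comp (tendsto_add_atTop_nat N)
  have hmass' : ∀ n, γ ≤ ∫ x in closedBall x₀ (Rm * Real.sqrt (T - s' n)), ‖u (s' n) x‖ ^ 3 :=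
    fun n => hall (n + N) (Nat.le_add_left N n)
  -- (2) zoom along `s'`
  obtain ⟨φ, hφ, U, hU, hvel, hcurl⟩ := exists_zoomLimit_at_singular_along₆₈ hT hcl hLH hI hsing hs' hs'T
  set lam : ℕ → ℝ := fun j => Real.sqrt (T - s' (φ j)) / 2 with hlamdef
  have hTs : ∀ j, 0 < T - s' (φ j) := fun j => by linarith [(hs' (φ j)).2]
  have hlam : ∀ j, 0 < lam j := fun j => by rw [hlamdef]; exact div_pos (Real.sqrt_pos.2 (hTs j)) two_pos
  have hlam0 : Tendsto lam atTop (𝓝 0) := by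
    have h1 : Tendsto (fun j => T - s' (φ j)) atTop (𝓝 0) := by
      have h : Tendsto (fun j => T - s' (φ j)) atTop (𝓝 (T - T)) :=
        tendsto_const_nhds.sub (hs'T.comp hφ.tendsto_atTop)
      rwa [sub_self] at h
    have h2 : Tendsto (fun j => Real.sqrt (T - s' (φ j))) atTop (𝓝 0) := by
      have h := (Real.continuous_sqrt.tendsto 0).comp h1
      rwa [Function.comp_def, Real.sqrt_zero] at h
    have h3 := h2.div_const 2
    rwa [zero_div] at h3
  have h4 : (-4 : ℝ) < 0 := by norm_num
  -- (3) the mass of the zoomed slices at `−4` and of the limit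
  have hslice : ∀ j, Continuous (u (s' (φ j))) := by
    intro j
    have hc : ContinuousOn (uncurry u) (Ico 0 T ×ˢ univ) := hcl.smooth_velocity.continuousOn
    have h := hc.comp_continuous (continuous_const.prodMk continuous_id)
      (fun x : EuclideanSpace ℝ (Fin 3) => (⟨⟨(hs' (φ j)).1.le, (hs' (φ j)).2⟩, mem_univ x⟩ :
        (s' (φ j), x) ∈ Ico 0 T ×ˢ univ))
    exact h
  have hzc : ∀ j, Continuous (fun y : EuclideanSpace ℝ (Fin 3) => lam j • u (s' (φ j)) (x₀ + lam j • y)) := by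
    intro j
    have h1 : Continuous (fun y : EuclideanSpace ℝ (Fin 3) => x₀ + lam j • id y) :=
      continuous_const.add (continuous_id.const_smul (lam j))
    exact ((hslice j).comp h1).const_smul (lam j)
  have hzb : ∀ j (y : EuclideanSpace ℝ (Fin 3)), ‖lam j • u (s' (φ j)) (x₀ + lam j • y)‖ ≤ M / 2 := by
    intro j y
    have h := hI _ (hs' (φ j)) (x₀ + lam j • y)
    have hsq : 0 < Real.sqrt (T - s' (φ j)) := Real.sqrt_pos.2 (hTs j)
    rw [le_div_iff₀ hsq] at h
    have e : lam j = Real.sqrt (T - s' (φ j)) / 2 := by simp only [hlamdef]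
    rw [norm_smul, Real.norm_of_nonneg (hlam j).le]
    calc lam j * ‖u (s' (φ j)) (x₀ + lam j • y)‖
        = ‖u (s' (φ j)) (x₀ + lam j • y)‖ * Real.sqrt (T - s' (φ j)) / 2 := by rw [e]; ring
      _ ≤ M / 2 := by gcongr
  have hzmass : ∀ j, γ ≤ ∫ y in closedBall (0 : EuclideanSpace ℝ (Fin 3)) (2 * Rm),
      ‖lam j • u (s' (φ j)) (x₀ + lam j • y)‖ ^ 3 := by
    intro j
    rw [setIntegral_norm_zoom_pow_three (u (s' (φ j))) x₀ (hlam j) (by positivity)]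
    have e : lam j * (2 * Rm) = Rm * Real.sqrt (T - s' (φ j)) := by simp only [hlamdef]; ring
    rw [e]
    exact hmass' (φ j)
  have hmassU : γ ≤ ∫ y in closedBall (0 : EuclideanSpace ℝ (Fin 3)) (2 * Rm), ‖U (-4) y‖ ^ 3 := by
    have hfin : IsFiniteMeasure (volume.restrict (closedBall (0 : EuclideanSpace ℝ (Fin 3)) (2 * Rm))) :=
      isFiniteMeasure_restrict.2 measure_closedBall_lt_top.ne
    have hT' : Tendsto (fun j => ∫ y in closedBall (0 : EuclideanSpace ℝ (Fin 3)) (2 * Rm),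
        ‖lam j • u (s' (φ j)) (x₀ + lam j • y)‖ ^ 3)
        atTop (𝓝 (∫ y in closedBall (0 : EuclideanSpace ℝ (Fin 3)) (2 * Rm), ‖U (-4) y‖ ^ 3)) := by
      refine tendsto_integral_of_dominated_convergence (fun _ => (M / 2) ^ 3)
        (fun j => ((hzc j).norm.pow 3).aestronglyMeasurable) (integrable_const _) ?_ ?_
      · intro j
        refine Eventually.of_forall fun y => ?_
        rw [Real.norm_of_nonneg (pow_nonneg (norm_nonneg _) 3)]
        exact pow_le_pow_left₀ (norm_nonneg _) (hzb j y) 3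
      · exact Eventually.of_forall fun y => ((hvel y).norm).pow 3
    exact ge_of_tendsto hT' (Eventually.of_forall hzmass)
  -- (4) the `δ₀`-coherence passes to `U(−4)` on `B(0,2R)` off the zero set
  have hcohU : ∀ y y' : EuclideanSpace ℝ (Fin 3), y ∈ ball (0 : EuclideanSpace ℝ (Fin 3)) (2 * R) →
      y' ∈ ball (0 : EuclideanSpace ℝ (Fin 3)) (2 * R) → curl (U (-4)) y ≠ 0 → curl (U (-4)) y' ≠ 0 →
        ‖vorticityDirection (curl (U (-4))) y' - vorticityDirection (curl (U (-4))) y‖ ≤ δ₀ := by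
    intro y y' hy hy' hcy hcy'
    -- pre-images in the balls `B(x₀, R√(T − s'))`
    have hmem : ∀ w : EuclideanSpace ℝ (Fin 3), w ∈ ball (0 : EuclideanSpace ℝ (Fin 3)) (2 * R) → ∀ j,
        x₀ + lam j • w ∈ ball x₀ (R * Real.sqrt (T - s' (φ j))) := by
      intro w hw j
      rw [mem_ball, dist_eq_norm, add_sub_cancel_left, norm_smul, Real.norm_of_nonneg (hlam j).le, hlamdef]
      dsimp only
      have hw' : ‖w‖ < 2 * R := mem_ball_zero_iff.1 hw
      have hsq : 0 < Real.sqrt (T - s' (φ j)) := Real.sqrt_pos.2 (hTs j)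
      nlinarith
    -- pre-images eventually above the threshold
    have hhigh : ∀ w : EuclideanSpace ℝ (Fin 3), curl (U (-4)) w ≠ 0 → ∀ᶠ j in atTop,
        d < ‖curl (u (s' (φ j))) (x₀ + lam j • w)‖ := by
      intro w hw
      have hc : 0 < ‖curl (U (-4)) w‖ := norm_pos_iff.2 hw
      have h1 : ∀ᶠ j in atTop,
          ‖curl (U (-4)) w‖ / 2 < ‖((T - s' (φ j)) / 4) • curl (u (s' (φ j))) (x₀ + lam j • w)‖ :=
        ((hcurl w).norm).eventually_const_lt (by linarith)
      have h2 : ∀ᶠ j in atTop, (T - s' (φ j)) / 4 * (|d| + 1) < ‖curl (U (-4)) w‖ / 2 := by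
        have hT' : Tendsto (fun j => (T - s' (φ j)) / 4 * (|d| + 1)) atTop (𝓝 0) := by
          have h : Tendsto (fun j => lam j ^ 2 * (|d| + 1)) atTop (𝓝 0) := by
            simpa using (hlam0.pow 2).mul_const (|d| + 1)
          refine h.congr fun j => ?_
          rw [hlamdef]
          dsimp only
          rw [div_pow, Real.sq_sqrt (hTs j).le]
          ring
        exact hT'.eventually_lt_const (by linarith)
      filter_upwards [h1, h2] with j hj1 hj2
      by_contra hle
      push Not at hle
      have hq : 0 ≤ (T - s' (φ j)) / 4 := by linarith [hTs j]
      rw [norm_smul, Real.norm_of_nonneg hq] at hj1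
      have h3 : (T - s' (φ j)) / 4 * ‖curl (u (s' (φ j))) (x₀ + lam j • w)‖ ≤ (T - s' (φ j)) / 4 * (|d| + 1) :=
        mul_le_mul_of_nonneg_left (hle.trans ((le_abs_self d).trans (by linarith))) hq
      linarith
    -- the hypothesis at the pre-images, eventually
    have hev : ∀ᶠ j in atTop,
        ‖‖((T - s' (φ j)) / 4) • curl (u (s' (φ j))) (x₀ + lam j • y')‖⁻¹ •
            (((T - s' (φ j)) / 4) • curl (u (s' (φ j))) (x₀ + lam j • y')) -
          ‖((T - s' (φ j)) / 4) • curl (u (s' (φ j))) (x₀ + lam j • y)‖⁻¹ •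
            (((T - s' (φ j)) / 4) • curl (u (s' (φ j))) (x₀ + lam j • y))‖ ≤ δ₀ := by
      filter_upwards [hhigh y hcy, hhigh y' hcy'] with j hdy hdy'
      have hq : 0 < (T - s' (φ j)) / 4 := by linarith [hTs j]
      -- LANDING NOTE (ns-s30-p1 g6): the text's helper `inv_norm_smul_smul_of_pos₆₇` restates landed lemmas in BOTH its
      -- forms (ℝ³: a ClockStretchingLaw module; general normed space: `Literature.AlgebraicTopology.SingularHomology.
      -- inv_norm_smul_smul`) — gate `dedup.landed` (p716755) — and importing either module into the NS lane for three
      -- lines is not worth the dependency, so the computation is a local `have`; statements byte-identical.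
      have hinv₆₇ : ∀ {c : ℝ}, 0 < c → ∀ v : EuclideanSpace ℝ (Fin 3), ‖c • v‖⁻¹ • (c • v) = ‖v‖⁻¹ • v :=
        fun {c} hc v => by
          by_cases hv : v = 0
          · simp [hv]
          · rw [norm_smul, Real.norm_eq_abs, abs_of_pos hc, mul_inv, smul_smul, mul_comm c⁻¹, mul_assoc,
              inv_mul_cancel₀ hc.ne', mul_one]
      rw [hinv₆₇ hq, hinv₆₇ hq, ← vorticityDirection_apply,
        ← vorticityDirection_apply, norm_sub_rev]
      exact hcoh (φ j + N) _ _ (hmem y hy j) (hmem y' hy' j) hdy hdy'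
    -- pass to the limit
    have hT' : ∀ w : EuclideanSpace ℝ (Fin 3), curl (U (-4)) w ≠ 0 →
        Tendsto (fun j => ‖((T - s' (φ j)) / 4) • curl (u (s' (φ j))) (x₀ + lam j • w)‖⁻¹ •
            (((T - s' (φ j)) / 4) • curl (u (s' (φ j))) (x₀ + lam j • w))) atTop
          (𝓝 (vorticityDirection (curl (U (-4))) w)) := by
      intro w hw
      have h1 := (continuousAt_inv_norm_smul hw).tendsto.comp (hcurl w)
      simpa only [Function.comp_def, vorticityDirection_apply] using h1
    exact le_of_tendsto (((hT' y' hcy').sub (hT' y hcy)).norm) hev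
  -- (5) contradiction with `sliceCoherence_smallMass`
  have hlt := hsmall U hU hcohU
  linarith

/-- ★★★★ **BARKER–PRANGE THEOREM 3 WITH A FIXED `δ₀`, REDUCED TO THE CONCENTRATION DOOR X.**
Assume `SliceL3Concentration`.  For every `M` and `R > 0` there is `δ₀ = δ₀(M,R) > 0` such that: if
`(u,p)` is a classical solution of the unit-viscosity unforced Navier–Stokes system on `ℝ³ × [0,T)`,
Leray–Hopf on `[0,T)`, with the global Type-I bound `|u| ≤ M/√(T − t)` on `(0,T)`, and if along SOME
sequence of times `s_n → T` in `(0,T)` the vorticity directions satisfy `|ξ(x,s_n) − ξ(y,s_n)| ≤ δ₀` for all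
`x, y ∈ B(x₀, R√(T − s_n))` with `|ω(·,s_n)| > d` at both points, then `(T,x₀)` is NOT a singular point.
Barker–Prange's Theorem 3 has `≤ η(|x − y|)` with a MODULUS `η` (so that the blow-up limit has PARALLEL
vorticity); here a FIXED `δ₀` — at the price of the door X, which supplies the non-degeneracy of the blow-up
limit that a fixed `δ₀` alone does not.  `δ₀` from `frequently_slice_smallMass_of_sliceAligned` at
`(M, R, R_m(M), γ(M))`.
[cite: BarkerPrange2020Alignment, Thm 3 (arXiv:1906.08225 p. 18); BarkerPrange2020, Thm 2;
GigaMiura2011, Thm 1.1] -/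
theorem sliceAligned_fixedDelta_not_singular_of_sliceL3Concentration (hX : SliceL3Concentration)
    (M : ℝ) {R : ℝ} (hR : 0 < R) :
    ∃ δ₀ : ℝ, 0 < δ₀ ∧
      ∀ (T : ℝ) (u : ℝ → EuclideanSpace ℝ (Fin 3) → EuclideanSpace ℝ (Fin 3))
        (p : ℝ → EuclideanSpace ℝ (Fin 3) → ℝ), 0 < T →
        IsClassicalNSSolutionOn (Ico 0 T) 1 0 u p → IsLerayHopfOn T 1 0 (u 0) u →
        (∀ t ∈ Ioo 0 T, ∀ x : EuclideanSpace ℝ (Fin 3), ‖u t x‖ ≤ M / Real.sqrt (T - t)) →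
        ∀ (x₀ : EuclideanSpace ℝ (Fin 3)) (d : ℝ) (s : ℕ → ℝ), (∀ n, s n ∈ Ioo 0 T) →
          Tendsto s atTop (𝓝 T) →
          (∀ (n : ℕ) (x y : EuclideanSpace ℝ (Fin 3)), x ∈ ball x₀ (R * Real.sqrt (T - s n)) →
            y ∈ ball x₀ (R * Real.sqrt (T - s n)) → d < ‖curl (u (s n)) x‖ → d < ‖curl (u (s n)) y‖ →
              ‖vorticityDirection (curl (u (s n))) x - vorticityDirection (curl (u (s n))) y‖ ≤ δ₀) →
          ¬ IsBackwardSingularPoint u (T, x₀) := by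
  obtain ⟨γ, Rm, hγ, hRm, hXc⟩ := hX M
  obtain ⟨δ₀, hδ₀, hcore⟩ := frequently_slice_smallMass_of_sliceAligned M hR hRm hγ
  refine ⟨δ₀, hδ₀, ?_⟩
  intro T u p hT hcl hLH hI x₀ d s hs hsT hcoh hsing
  obtain ⟨t₁, ht₁, hmass⟩ := hXc T u p hT hcl hLH hI x₀ hsing
  obtain ⟨N, hN⟩ : ∃ N : ℕ, ∀ n ≥ N, t₁ < s n :=
    eventually_atTop.1 (hsT.eventually (Ioi_mem_nhds ht₁))
  obtain ⟨n, hn, hlt⟩ := hcore T u p hT hcl hLH hI x₀ d s hs hsT hcoh hsing N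
  have hge := hmass (s n) ⟨hN n hn, (hs n).2⟩
  linarith

end Summit.NavierStokesRegularity.NavierStokesRegularity.Theorems.StrainDoors

end
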